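import Literature.NumberTheory.Automorphic.QuaternionAlgebraExistence
import Literature.NumberTheory.QuadraticForms.NormIndexFromReciprocityProofs
import HarnessLib

/-!
# Quaternion algebras with prescribed ramification exist, given Hilbert reciprocity
# (Vignéras III Thm. 3.1, existence) — and unconditionally over `ℚ`

Sibling proof file of `Literature.NumberTheory.Automorphic.QuaternionAlgebraAdelic` and
`….QuaternionAlgebraExistence` (namespace `Literature.NumberTheory.Automorphic`), all declarations
fully proved. `QuaternionAlgebraExistence.lean` reduces the named fact
`exists_isQuaternionAlgebra_of_even K` (Vignéras, LNM 800, Ch. III §3 Thm. 3.1, existence half of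
the classification: for finite places `S` and real places `T` with `|S| + |T|` even there is a
quaternion algebra over `K` ramified exactly at `S ∪ T`) to O'Meara 71:19
(`QuadraticForms.exists_hilbertSymbol_eq_neg_one_iff K`), and
`QuadraticForms/NormIndexFromReciprocityProofs.lean` proves 71:19 from Hilbert's reciprocity law
71:18 alone (the norm index theorem 65:21, the Global Square Theorem 65:15, the places of 65:18
and the local index 63:13 all being theorems of the tree now). Hence:

* `exists_isQuaternionAlgebra_of_even_of_hilbertReciprocity` — **Vignéras III Thm. 3.1
  (existence) for `K` follows from `QuadraticForms.hilbertReciprocity K`** (Vignéras III Cor. 3.3 =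
  O'Meara 71:18), the one named fact left under it;
* `exists_isQuaternionAlgebra_of_even_rat : exists_isQuaternionAlgebra_of_even ℚ` — **over `ℚ` the
  existence theorem holds unconditionally**, Hilbert reciprocity over `ℚ` being the theorem
  `QuadraticForms.hilbertReciprocity_rat` (quadratic reciprocity and the supplements).

## References

* M.-F. Vignéras, *Arithmétique des algèbres de quaternions*, LNM 800 (1980), Ch. III §3,
  Thm. 3.1 (existence), Cor. 3.3 (the product formula for the Hilbert symbol), Thm. 3.7, Thm. 3.8.
* O. T. O'Meara, *Introduction to quadratic forms*, Grundlehren 117, Springer (1963), 71:18, 71:19.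
-/

noncomputable section

namespace Literature.NumberTheory.Automorphic

/-- **Classification of quaternion algebras over a number field, existence half, from Hilbert
reciprocity** (Vignéras III §3 Thm. 3.1 via Cor. 3.3): if the Hilbert symbol of `K` satisfies the
product formula `∏_v (a, b)_v = 1` (`QuadraticForms.hilbertReciprocity K a b` for all `a b`), then
for every finite set `S` of finite places and every finite set `T` of real places with `|S| + |T|`
even there is a quaternion algebra over `K` ramified exactly at `S` and at `T`
(`exists_isQuaternionAlgebra_of_even K`): `exists_isQuaternionAlgebra_of_even_of_exists_hilbertSymbol_eq_neg_one_iff`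
with O'Meara 71:19 supplied by `QuadraticForms.exists_hilbertSymbol_eq_neg_one_iff_of_hilbertReciprocity`.
[cite: VignerasLNM800, Ch. III §3 Thm. 3.1 (existence) and Cor. 3.3] -/
theorem exists_isQuaternionAlgebra_of_even_of_hilbertReciprocity (K : Type) [Field K] [NumberField K]
    (h71 : ∀ a b : K, QuadraticForms.hilbertReciprocity K a b) :
    exists_isQuaternionAlgebra_of_even K :=
  exists_isQuaternionAlgebra_of_even_of_exists_hilbertSymbol_eq_neg_one_iff K
    (QuadraticForms.exists_hilbertSymbol_eq_neg_one_iff_of_hilbertReciprocity K h71)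

/-- **Quaternion algebras over `ℚ` with prescribed ramification exist** (Vignéras III Thm. 3.1,
existence, for `K = ℚ`; classically: for an even number of places `p_1, …, p_r, (∞)` of `ℚ` there
is a rational quaternion algebra ramified exactly there): the named fact
`exists_isQuaternionAlgebra_of_even ℚ` holds unconditionally, by
`exists_isQuaternionAlgebra_of_even_of_hilbertReciprocity` and the theorem
`QuadraticForms.hilbertReciprocity_rat` (Hilbert reciprocity over `ℚ`).
[cite: VignerasLNM800, Ch. III §3 Thm. 3.1 (existence)] -/
theorem exists_isQuaternionAlgebra_of_even_rat : exists_isQuaternionAlgebra_of_even ℚ :=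
  exists_isQuaternionAlgebra_of_even_of_hilbertReciprocity ℚ QuadraticForms.hilbertReciprocity_rat

/-- **Vignéras III Thm. 3.1 (existence) for a number field `K` from its one NAMED-FACT leaf**
(fact decomposition of `exists_isQuaternionAlgebra_of_even`, librarian sweep `libsplit-39`,
2026-08-16). The existence half of the classification of quaternion algebras over `K` is PROVED in
the tree from exactly one undischarged named fact, Hilbert's reciprocity law for `K`
(`QuadraticForms.hilbertReciprocity K a b` for all `a b`, O'Meara 71:18 = Vignéras III Cor. 3.3 —
the printed input of Thm. 3.1), by `exists_isQuaternionAlgebra_of_even_of_hilbertReciprocity`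
(O'Meara 71:19 being proved from 71:18 in `QuadraticForms/NormIndexFromReciprocityProofs.lean`).
In turn `hilbertReciprocity K` is reduced in the tree to O'Meara 71:17 alone
(`QuadraticForms.hilbertReciprocity_of_inert`, `QuaternionAlgebraExistenceInert.lean`: the second
inequality 65:21 and Hasse's norm theorem are theorems), and holds over `ℚ`
(`QuadraticForms.hilbertReciprocity_rat`, whence `exists_isQuaternionAlgebra_of_even_rat` above).
So `exists_isQuaternionAlgebra_of_even_holds K` will read
`exists_isQuaternionAlgebra_of_even_holds_of K (QuadraticForms.hilbertReciprocity_holds K)`.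
[cite: VignerasLNM800, Ch. III §3 Thm. 3.1 (existence) and Cor. 3.3] -/
theorem exists_isQuaternionAlgebra_of_even_holds_of (K : Type) [Field K] [NumberField K]
    (h : ∀ a b : K, QuadraticForms.hilbertReciprocity K a b) :
    exists_isQuaternionAlgebra_of_even K :=
  exists_isQuaternionAlgebra_of_even_of_hilbertReciprocity K h

end Literature.NumberTheory.Automorphic
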